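import Mathlib.Analysis.PSeries
import Mathlib.Analysis.SpecialFunctions.ImproperIntegrals
import Literature.MathematicalPhysics.KineticTheory.InfiniteChainWeakLimit
import Literature.MathematicalPhysics.KineticTheory.InfiniteChainGibbsMomenta
import Literature.MathematicalPhysics.KineticTheory.InfiniteChainSeveredGibbs
import HarnessLib

/-!
# Lanford–Lebowitz–Lieb 1977, Theorem 3 (weak existence for a.e. initial point): proof

Topic `Literature/MathematicalPhysics/KineticTheory`; proofs-only companion of
`InfiniteChainDynamics.lean`. It DISCHARGES the named fact
`OscillatorChain.LanfordLebowitzLieb1977_thm3_chain` (O. E. Lanford III, J. L. Lebowitz,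
E. H. Lieb, *Time evolution of infinite anharmonic systems*, J. Stat. Phys. **16** (1977) 453–461,
§4, Theorem 3, pp. 459–460) by `OscillatorChain.LanfordLebowitzLieb1977_thm3_chain_holds`,
assembling: the severed flows `T_t^Λ` of (9a)–(9c) (`InfiniteChainSevered.lean`), their
invariance of Gibbs states, LLL §4 remark (i) (`InfiniteChainSeveredGibbs.lean`), the Gaussian law
of the momenta, remark (ii) (`InfiniteChainGibbsMomenta.lean`), and the deterministic step
(16) ⇒ (15) with the compactness of the Thm 1 proof (`InfiniteChainWeakLimit.lean`).

This file proves the measure-theoretic core of the printed proof, in abstract form, and the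
assembly:

* `ae_liminf_lintegral_lt_top_of_measurePreserving`: if maps `T_n(t, ·)` preserve `μ`
  (jointly measurable in `(t, x)`), `B ≥ 0` has `∫ B dμ < ∞` and `w ≥ 0` has `∫ w dt < ∞`, then
  `B̄_n(x) = ∫ w(t) B(T_n(t, x)) dt` satisfies `∫ B̄_n dμ = (∫ w)(∫ B dμ)` (Fubini and invariance),
  hence `liminf_n B̄_n < ∞` `μ`-a.e. (Fatou) — LLL's "from (i) and Fubini's theorem, `∫ B̄_α dμ`
  is finite and independent of `α`. By Fatou's lemma, `∫ B̄ dμ < ∞`";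
* `momSup x = sup_i |p_i| / [log₊ i]^{1/2}` (LLL's `B`), measurable;
* `ae_exists_isSolution_of_measurePreserving`: for a family of jointly measurable, `μ`-preserving
  severed flows in boxes exhausting `ℤ` and `∫ B dμ < ∞`, `μ`-a.e. initial point admits a global
  solution of (1a)–(1c) with the bound (15) (a subsequence with `B̄_{α_n}(x) ≤ C`, then
  `InfiniteChainWeakLimit.exists_isSolution_of_severed_bound`);
* `lintegral_momSup_ne_top`: `∫ B dμ < ∞` from the Gaussian exponential moments
  `∫ e^{p_i²/(4T)} dμ = √2` ("it follows from (ii) that `∫ B dμ < ∞`");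
* `LanfordLebowitzLieb1977_thm3_chain_holds`: Theorem 3 for the chain, with the boxes
  `Λ_n = {-n, …, n}` and `T_n = severedFlow hB1 (box n)`.

Everything here is proved; no named facts. [cite: LanfordLebowitzLieb1977, §4 Thm 3]

## References

* O. E. Lanford III, J. L. Lebowitz, E. H. Lieb, *Time evolution of infinite anharmonic systems*,
  J. Stat. Phys. 16 (1977) 453–461, doi:10.1007/bf01152283, §4 Theorem 3. [LanfordLebowitzLieb1977]
-/

noncomputable section

open MeasureTheory Filter Topology Set
open scoped ENNReal

namespace Literature.MathematicalPhysics.KineticTheory.HeatConduction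

namespace OscillatorChain

/-! ### Fubini + invariance + Fatou (abstract) -/

/-- **LLL 1977, proof of Thm 3, the Fubini–Fatou step (abstract form).** Let `T_n : ℝ × X → X` be
jointly measurable with every `T_n(t, ·)` preserving `μ`, `B : X → [0, ∞]` measurable with
`∫ B dμ < ∞`, and `w : ℝ → [0, ∞]` measurable with `∫ w < ∞`. Then
`∫ (∫ w(t) B(T_n(t, x)) dt) dμ(x) = (∫ w) (∫ B dμ)` for every `n`. [cite: LanfordLebowitzLieb1977, §4 Thm 3, proof] -/
theorem lintegral_lintegral_comp_measurePreserving {X : Type*} [MeasurableSpace X]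
    {μ : Measure X} [SFinite μ] {T : ℝ → X → X} (hTm : Measurable fun p : ℝ × X => T p.1 p.2)
    (hTμ : ∀ t, MeasurePreserving (T t) μ μ) {B : X → ℝ≥0∞} (hBm : Measurable B)
    {w : ℝ → ℝ≥0∞} (hwm : Measurable w) :
    ∫⁻ x, (∫⁻ t, w t * B (T t x)) ∂μ = (∫⁻ t, w t) * ∫⁻ x, B x ∂μ := by
  have hf : Measurable fun q : X × ℝ => w q.2 * B (T q.2 q.1) :=
    (hwm.comp measurable_snd).mul (hBm.comp (hTm.comp measurable_swap))
  calc ∫⁻ x, (∫⁻ t, w t * B (T t x)) ∂μ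
      = ∫⁻ t, ∫⁻ x, w t * B (T t x) ∂μ :=
        lintegral_lintegral_swap hf.aemeasurable
    _ = ∫⁻ t, w t * ∫⁻ x, B x ∂μ := by
        refine lintegral_congr fun t => ?_
        have hm : Measurable fun x => B (T t x) := hBm.comp (hTμ t).measurable
        rw [lintegral_const_mul _ hm, (hTμ t).lintegral_comp hBm]
    _ = (∫⁻ t, w t) * ∫⁻ x, B x ∂μ := lintegral_mul_const _ hwm

/-- **LLL 1977, proof of Thm 3: `liminf_n B̄_n < ∞` almost everywhere.** With `T_n, B, w` as in
`lintegral_lintegral_comp_measurePreserving`, `∫ B dμ < ∞` and `∫ w < ∞`, for `μ`-a.e. `x` the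
numbers `B̄_n(x) = ∫ w(t) B(T_n(t, x)) dt` have finite `liminf` (Fatou). [cite: LanfordLebowitzLieb1977, §4 Thm 3, proof] -/
theorem ae_liminf_lintegral_lt_top_of_measurePreserving {X : Type*} [MeasurableSpace X]
    {μ : Measure X} [SFinite μ] {T : ℕ → ℝ → X → X}
    (hTm : ∀ n, Measurable fun p : ℝ × X => T n p.1 p.2)
    (hTμ : ∀ n t, MeasurePreserving (T n t) μ μ) {B : X → ℝ≥0∞} (hBm : Measurable B)
    (hB : ∫⁻ x, B x ∂μ ≠ ∞) {w : ℝ → ℝ≥0∞} (hwm : Measurable w) (hw : ∫⁻ t, w t ≠ ∞) :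
    ∀ᵐ x ∂μ, liminf (fun n => ∫⁻ t, w t * B (T n t x)) atTop < ∞ := by
  have hGm : ∀ n, Measurable fun x => ∫⁻ t, w t * B (T n t x) := fun n => by
    have hf : Measurable fun q : X × ℝ => w q.2 * B (T n q.2 q.1) :=
      (hwm.comp measurable_snd).mul (hBm.comp ((hTm n).comp measurable_swap))
    exact hf.lintegral_prod_right'
  refine ae_lt_top (Measurable.liminf hGm) (ne_top_of_le_ne_top (ENNReal.mul_ne_top hw hB) ?_)
  calc ∫⁻ x, liminf (fun n => ∫⁻ t, w t * B (T n t x)) atTop ∂μ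
      ≤ liminf (fun n => ∫⁻ x, (∫⁻ t, w t * B (T n t x)) ∂μ) atTop := lintegral_liminf_le hGm
    _ = liminf (fun _ : ℕ => (∫⁻ t, w t) * ∫⁻ x, B x ∂μ) atTop := by
        refine congrArg (fun f : ℕ → ℝ≥0∞ => liminf f atTop) (funext fun n => ?_)
        exact lintegral_lintegral_comp_measurePreserving (hTm n) (hTμ n) hBm hwm
    _ = (∫⁻ t, w t) * ∫⁻ x, B x ∂μ := liminf_const _

/-- The Cauchy weight `1 / (1 + t²)` has finite integral (`= π`). [folklore] -/
theorem lintegral_inv_one_add_sq_ne_top :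
    ∫⁻ t : ℝ, ENNReal.ofReal ((1 + t ^ 2)⁻¹) ≠ ∞ := by
  rw [← ofReal_integral_eq_lintegral_ofReal integrable_inv_one_add_sq
    (Eventually.of_forall fun t => by positivity)]
  exact ENNReal.ofReal_ne_top

/-- The Cauchy weight is measurable. [folklore] -/
theorem measurable_inv_one_add_sq : Measurable fun t : ℝ => ENNReal.ofReal ((1 + t ^ 2)⁻¹) :=
  ENNReal.measurable_ofReal.comp (by fun_prop)

/-! ### LLL's `B(x) = sup_i |p_i| / [log₊ i]^{1/2}` -/

/-- LLL's `B(x) = sup_i |p_i| / [log₊(i)]^{1/2}`, as an `[0, ∞]`-valued function of the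
configuration (LLL 1977, proof of Thm 3). [cite: LanfordLebowitzLieb1977, §4 Thm 3, proof] -/
def momSup (x : ChainConfig) : ℝ≥0∞ :=
  ⨆ i : ℤ, ENNReal.ofReal (|(x i).2| / Real.sqrt (logPlus i))

/-- `B` is measurable. [folklore] -/
theorem measurable_momSup : Measurable momSup := by
  refine Measurable.iSup fun i => ENNReal.measurable_ofReal.comp ?_
  have h : Measurable fun x : ChainConfig => (x i).2 := (measurable_pi_apply i).snd
  exact (continuous_abs.measurable.comp h).div_const _

/-- Each term is below the supremum: `|p_i| / [log₊ i]^{1/2} ≤ B(x)`. [folklore] -/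
theorem ofReal_div_le_momSup (x : ChainConfig) (i : ℤ) :
    ENNReal.ofReal (|(x i).2| / Real.sqrt (logPlus i)) ≤ momSup x :=
  le_iSup (fun i : ℤ => ENNReal.ofReal (|(x i).2| / Real.sqrt (logPlus i))) i

/-- **From `B̄` to the weighted momentum integrals of (16).** Along any curve `z`,
`∫ |p_i(z(s))| / (1 + s²) ds ≤ (∫ B(z(s)) / (1 + s²) ds) · [log₊ i]^{1/2}`. [cite: LanfordLebowitzLieb1977, §4 Thm 3, proof, eq. (16)] -/
theorem lintegral_abs_snd_le_lintegral_momSup (z : ℝ → ChainConfig) (i : ℤ) :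
    ∫⁻ s, ENNReal.ofReal (|(z s i).2| / (1 + s ^ 2)) ≤
      (∫⁻ s, ENNReal.ofReal ((1 + s ^ 2)⁻¹) * momSup (z s)) *
        ENNReal.ofReal (Real.sqrt (logPlus i)) := by
  rw [← lintegral_mul_const' _ _ ENNReal.ofReal_ne_top]
  refine lintegral_mono fun s => ?_
  have hL : 0 < Real.sqrt (logPlus i) := Real.sqrt_pos.2 (logPlus_pos i)
  have hs : 0 < 1 + s ^ 2 := by positivity
  have e : |(z s i).2| / (1 + s ^ 2) =
      (1 + s ^ 2)⁻¹ * (|(z s i).2| / Real.sqrt (logPlus i)) * Real.sqrt (logPlus i) := by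
    field_simp
  rw [e, ENNReal.ofReal_mul (by positivity), ENNReal.ofReal_mul (by positivity)]
  gcongr
  exact ofReal_div_le_momSup (z s) i

/-! ### `∫ B dμ < ∞` from Gaussian exponential moments -/

/-- Elementary: `(a - c)₊ ≤ e^{θ(a² - c²)} / (2θc)` for `a ≥ 0`, `c, θ > 0` (from `1 + y ≤ e^y`).
[folklore] -/
theorem sub_le_exp_div {a c θ : ℝ} (ha : 0 ≤ a) (hc : 0 < c) (hθ : 0 < θ) :
    a - c ≤ Real.exp (θ * (a ^ 2 - c ^ 2)) / (2 * θ * c) := by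
  rw [le_div_iff₀ (by positivity)]
  rcases le_or_gt a c with hac | hac
  · exact (mul_nonpos_of_nonpos_of_nonneg (by linarith) (by positivity)).trans (Real.exp_pos _).le
  · have h1 := Real.add_one_le_exp (θ * (a ^ 2 - c ^ 2))
    have h2 : 0 ≤ θ * (a ^ 2 - c ^ 2) := mul_nonneg hθ.le (by nlinarith)
    nlinarith [mul_nonneg hθ.le (mul_nonneg (by linarith : 0 ≤ a - c) (by linarith : 0 ≤ a - c))]

/-- `∑_{j ∈ ℤ} e^{-2 log₊ j} < ∞` (comparison with `∑ 1/j²`). [folklore] -/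
theorem tsum_exp_neg_two_logPlus_ne_top :
    ∑' j : ℤ, ENNReal.ofReal (Real.exp (-2 * logPlus j)) ≠ ∞ := by
  have hle : ∀ j : ℤ, ENNReal.ofReal (Real.exp (-2 * logPlus j)) ≤
      ENNReal.ofReal (1 / (j : ℝ) ^ 2) + if j = 0 then 1 else 0 := by
    intro j
    by_cases hj : j = 0
    · subst hj
      simp only [if_true]
      refine le_add_left ?_
      rw [← ENNReal.ofReal_one]
      exact ENNReal.ofReal_le_ofReal (Real.exp_le_one_iff.2 (by linarith [logPlus_pos 0]))
    · simp only [hj, if_false, add_zero]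
      refine ENNReal.ofReal_le_ofReal ?_
      have hj' : 0 < |(j : ℝ)| := abs_pos.2 (by exact_mod_cast hj)
      have h1 : Real.log |(j : ℝ)| ≤ logPlus j := le_max_left _ _
      calc Real.exp (-2 * logPlus j) ≤ Real.exp (-2 * Real.log |(j : ℝ)|) :=
            Real.exp_le_exp.2 (by linarith)
        _ = 1 / (j : ℝ) ^ 2 := by
            rw [show (-2 : ℝ) * Real.log |(j : ℝ)| = -(Real.log |(j : ℝ)| + Real.log |(j : ℝ)|) by ring,
              Real.exp_neg, Real.exp_add, Real.exp_log hj', ← sq, sq_abs, one_div]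
  refine ne_top_of_le_ne_top ?_ (ENNReal.tsum_le_tsum hle)
  rw [ENNReal.tsum_add, tsum_ite_eq]  -- sum of the two bounds
  refine ENNReal.add_ne_top.2 ⟨?_, ENNReal.one_ne_top⟩
  have hs : Summable fun j : ℤ => 1 / (j : ℝ) ^ 2 := Real.summable_one_div_int_pow.2 one_lt_two
  rw [← ENNReal.ofReal_tsum_of_nonneg (fun j => by positivity) hs]
  exact ENNReal.ofReal_ne_top

/-- **`∫ B dμ < ∞` from Gaussian exponential moments** (LLL 1977, proof of Thm 3: "it follows
from (ii) that `∫ B dμ < ∞`"). If `∫ e^{p_i²/(4T)} dμ ≤ A < ∞` for every site `i` (true with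
`A = √2` when each `p_i` is `N(0, T)`), then `B = sup_i |p_i| / [log₊ i]^{1/2}` is `μ`-integrable:
`B ≤ c + ∑_i (|p_i|/[log₊ i]^{1/2} - c)₊` with `c = √(8T)`, and
`(a_i - c)₊ ≤ (2T/c) e^{-2 log₊ i} e^{p_i²/(4T)}`. [cite: LanfordLebowitzLieb1977, §4 Thm 3, proof] -/
theorem lintegral_momSup_ne_top {μ : Measure ChainConfig} [IsFiniteMeasure μ] {T : ℝ} (hT : 0 < T)
    {A : ℝ≥0∞} (hA : A ≠ ∞)
    (hexp : ∀ i : ℤ, ∫⁻ x, ENNReal.ofReal (Real.exp ((x i).2 ^ 2 / (4 * T))) ∂μ ≤ A) :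
    ∫⁻ x, momSup x ∂μ ≠ ∞ := by
  set c : ℝ := Real.sqrt (8 * T) with hc
  have hc0 : 0 < c := Real.sqrt_pos.2 (by positivity)
  have hcsq : c ^ 2 = 8 * T := Real.sq_sqrt (by positivity)
  -- the summands `(a_i - c)₊` and their pointwise bound
  set a : ChainConfig → ℤ → ℝ := fun x i => |(x i).2| / Real.sqrt (logPlus i) with ha
  have ha0 : ∀ x i, 0 ≤ a x i := fun x i => by positivity
  have ham : ∀ i, Measurable fun x => ENNReal.ofReal (a x i - c) := fun i => by
    refine ENNReal.measurable_ofReal.comp (Measurable.sub_const ?_ c)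
    exact (continuous_abs.measurable.comp (measurable_pi_apply i).snd).div_const _
  have hbound : ∀ x i, a x i - c ≤
      (2 * T / c) * Real.exp (-2 * logPlus i) * Real.exp ((x i).2 ^ 2 / (4 * T)) := by
    intro x i
    have hL := logPlus_pos i
    have hL1 := one_le_logPlus i
    have hθ : 0 < logPlus i / (4 * T) := by positivity
    refine (sub_le_exp_div (ha0 x i) hc0 hθ).trans ?_
    have hsq : a x i ^ 2 = (x i).2 ^ 2 / logPlus i := by
      simp only [ha]
      rw [div_pow, sq_abs, Real.sq_sqrt hL.le]
    have hexp_eq : logPlus i / (4 * T) * (a x i ^ 2 - c ^ 2) =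
        -2 * logPlus i + (x i).2 ^ 2 / (4 * T) := by
      rw [hsq, hcsq]
      field_simp
      ring
    rw [hexp_eq, Real.exp_add, div_le_iff₀ (by positivity)]
    have hpos : 0 ≤ Real.exp (-2 * logPlus i) * Real.exp ((x i).2 ^ 2 / (4 * T)) := by positivity
    -- `E ≤ (2T/c) E · (2 θ c)` since `2 θ c · 2T/c = logPlus i ≥ 1`
    have key : (2 * T / c) * (2 * (logPlus i / (4 * T)) * c) = logPlus i := by
      field_simp
      ring
    nlinarith [mul_le_mul_of_nonneg_left hL1 hpos]
  -- `B ≤ c + ∑_i (a_i - c)₊`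
  have hB : ∀ x, momSup x ≤ ENNReal.ofReal c + ∑' i : ℤ, ENNReal.ofReal (a x i - c) := by
    intro x
    refine iSup_le fun i => ?_
    calc ENNReal.ofReal (a x i) = ENNReal.ofReal (c + (a x i - c)) := by ring_nf
      _ ≤ ENNReal.ofReal c + ENNReal.ofReal (a x i - c) := ENNReal.ofReal_add_le
      _ ≤ ENNReal.ofReal c + ∑' j : ℤ, ENNReal.ofReal (a x j - c) :=
          add_le_add le_rfl (ENNReal.le_tsum i)
  -- integrate
  have hint : ∀ i, ∫⁻ x, ENNReal.ofReal (a x i - c) ∂μ ≤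
      ENNReal.ofReal ((2 * T / c) * Real.exp (-2 * logPlus i)) * A := by
    intro i
    calc ∫⁻ x, ENNReal.ofReal (a x i - c) ∂μ
        ≤ ∫⁻ x, ENNReal.ofReal ((2 * T / c) * Real.exp (-2 * logPlus i)) *
            ENNReal.ofReal (Real.exp ((x i).2 ^ 2 / (4 * T))) ∂μ := by
          refine lintegral_mono fun x => ?_
          rw [← ENNReal.ofReal_mul (by positivity)]
          exact ENNReal.ofReal_le_ofReal (hbound x i)
      _ = ENNReal.ofReal ((2 * T / c) * Real.exp (-2 * logPlus i)) *
            ∫⁻ x, ENNReal.ofReal (Real.exp ((x i).2 ^ 2 / (4 * T))) ∂μ :=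
          lintegral_const_mul' _ _ ENNReal.ofReal_ne_top
      _ ≤ ENNReal.ofReal ((2 * T / c) * Real.exp (-2 * logPlus i)) * A := by
          gcongr
          exact hexp i
  have htsum : ∑' i : ℤ, ENNReal.ofReal ((2 * T / c) * Real.exp (-2 * logPlus i)) * A ≠ ∞ := by
    have e : ∀ i : ℤ, ENNReal.ofReal ((2 * T / c) * Real.exp (-2 * logPlus i)) * A =
        (ENNReal.ofReal (2 * T / c) * A) * ENNReal.ofReal (Real.exp (-2 * logPlus i)) := by
      intro i
      rw [ENNReal.ofReal_mul (by positivity)]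
      ring
    simp_rw [e]
    rw [ENNReal.tsum_mul_left]
    exact ENNReal.mul_ne_top (ENNReal.mul_ne_top ENNReal.ofReal_ne_top hA)
      tsum_exp_neg_two_logPlus_ne_top
  refine ne_top_of_le_ne_top ?_ (lintegral_mono hB)
  rw [lintegral_add_left measurable_const, lintegral_const,
    lintegral_tsum fun i => (ham i).aemeasurable]
  refine ENNReal.add_ne_top.2 ⟨ENNReal.mul_ne_top ENNReal.ofReal_ne_top (measure_ne_top μ _), ?_⟩
  exact ne_top_of_le_ne_top htsum (ENNReal.tsum_le_tsum hint)

/-! ### Theorem 3 for measure-preserving severed flows with `∫ B dμ < ∞` -/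

/-- **LLL 1977, Theorem 3, abstract form.** Let `U', V'` be continuous, `Λ_n` finite boxes
eventually containing every site, and `T_n : ℝ × Ω → Ω` jointly measurable maps such that each
`t ↦ T_n(t, x)` is a severed solution ((9a)–(9c) in `Λ_n`) starting at `x` and each `T_n(t, ·)`
preserves the measure `μ`. If `∫ B dμ < ∞` (`B = momSup`), then for `μ`-a.e. `x` there is a
solution of (1a)–(1c) for all times starting at `x` and satisfying (15),
`|q_i(t) - q_i| ≤ C (1 + t²) [log₊ i]^{1/2}`. (Printed proof: `∫ B̄_n dμ = π ∫ B dμ`, Fatou, a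
subsequence with `B̄_{n_k}(x) ≤ C`, (16), compactness as in Thm 1.) [cite: LanfordLebowitzLieb1977, §4 Thm 3] -/
theorem ae_exists_isSolution_of_measurePreserving {P : OscillatorChain}
    (hUc : Continuous (deriv P.U)) (hVc : Continuous (deriv P.V)) {μ : Measure ChainConfig}
    [SFinite μ] {Λ : ℕ → Finset ℤ} (hΛ : ∀ j : ℤ, ∀ᶠ n in atTop, j ∈ Λ n)
    {T : ℕ → ℝ → ChainConfig → ChainConfig}
    (hTm : ∀ n, Measurable fun p : ℝ × ChainConfig => T n p.1 p.2)
    (hT0 : ∀ n x, T n 0 x = x) (hTs : ∀ n x, P.IsSeveredSolution (Λ n) fun t => T n t x)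
    (hTμ : ∀ n t, MeasurePreserving (T n t) μ μ) (hB : ∫⁻ x, momSup x ∂μ ≠ ∞) :
    ∀ᵐ x ∂μ, ∃ γ : ℝ → ChainConfig, γ 0 = x ∧ P.IsSolution γ ∧
      ∃ C : ℝ, ∀ (t : ℝ) (i : ℤ),
        |(γ t i).1 - (x i).1| ≤ C * (1 + t ^ 2) * Real.sqrt (max (Real.log |(i : ℝ)|) 1) := by
  filter_upwards [ae_liminf_lintegral_lt_top_of_measurePreserving hTm hTμ measurable_momSup hB
    measurable_inv_one_add_sq lintegral_inv_one_add_sq_ne_top] with x hx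
  set G : ℕ → ℝ≥0∞ := fun n => ∫⁻ t, ENNReal.ofReal ((1 + t ^ 2)⁻¹) * momSup (T n t x) with hG
  set L : ℝ≥0∞ := liminf G atTop with hLdef
  have hL : L ≠ ∞ := hx.ne
  have hL1 : L + 1 ≠ ∞ := ENNReal.add_ne_top.2 ⟨hL, ENNReal.one_ne_top⟩
  -- a subsequence along which `B̄_n(x) ≤ L + 1`
  have hfreq : ∃ᶠ n in atTop, G n < L + 1 :=
    frequently_lt_of_liminf_lt (by isBoundedDefault) (ENNReal.lt_add_right hL one_ne_zero)
  obtain ⟨φ, hφ, hφG⟩ := extraction_of_frequently_atTop hfreq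
  set C : ℝ := (L + 1).toReal with hC
  have hC0 : 0 ≤ C := ENNReal.toReal_nonneg
  have hΛ' : ∀ j : ℤ, ∀ᶠ k in atTop, j ∈ Λ (φ k) := fun j => hφ.tendsto_atTop.eventually (hΛ j)
  obtain ⟨γ, hγ0, hγs, hγb⟩ := exists_isSolution_of_severed_bound hUc hVc hC0 hΛ'
    (y := fun k t => T (φ k) t x) (fun k => hT0 (φ k) x) (fun k => hTs (φ k) x)
    (fun k i _ => by
      calc ∫⁻ s, ENNReal.ofReal (|(T (φ k) s x i).2| / (1 + s ^ 2))
          ≤ G (φ k) * ENNReal.ofReal (Real.sqrt (logPlus i)) :=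
            lintegral_abs_snd_le_lintegral_momSup (fun s => T (φ k) s x) i
        _ ≤ (L + 1) * ENNReal.ofReal (Real.sqrt (logPlus i)) := by
            gcongr
            exact (hφG k).le
        _ = ENNReal.ofReal (C * Real.sqrt (logPlus i)) := by
            rw [ENNReal.ofReal_mul hC0, hC, ENNReal.ofReal_toReal hL1])
  exact ⟨γ, hγ0, hγs, C, hγb⟩

/-! ### Theorem 3 -/

/-- Every site eventually belongs to the boxes `Λ_n = {-n, …, n}`. [folklore] -/
theorem eventually_mem_chainBox (j : ℤ) : ∀ᶠ n : ℕ in atTop, j ∈ box n := by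
  filter_upwards [eventually_ge_atTop ⌈|(j : ℝ)|⌉₊] with n hn
  exact mem_box_of_abs_le ((Nat.le_ceil _).trans (by exact_mod_cast hn))

/-- **Lanford–Lebowitz–Lieb 1977, Theorem 3, for the nearest-neighbour chain — proved.**
Discharges the named fact `LanfordLebowitzLieb1977_thm3_chain`: under A2 (`U, V ∈ C²`), B1
(global severed dynamics) and B2 (normalisable finite-volume Gibbs distributions at `T > 0`), for
every Gibbs state `μ` and `μ`-a.e. initial point there is a solution of (1a)–(1c) for all times
with `sup_t sup_i |q_i(t) - q_i| / ((1 + t²) [log₊ i]^{1/2}) < ∞` (15). Proof as printed (§4,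
pp. 459–460): the severed flows `T_t^{Λ_n}` (`severedFlow`, B1 + A2) preserve `μ` (remark (i),
Liouville + conservation of `H_Λ`, `measurePreserving_severedFlow_of_isChainGibbsMeasure`); the
momenta are `N(0, T)` under `μ` (remark (ii), `lintegral_exp_sq_snd`), so `∫ B dμ < ∞`
(`lintegral_momSup_ne_top`); Fubini + Fatou give `liminf_n B̄_n < ∞` a.e., a subsequence with
`B̄ ≤ C`, the bound (16), and compactness as in Theorem 1
(`ae_exists_isSolution_of_measurePreserving`). [cite: LanfordLebowitzLieb1977, §4 Thm 3] -/
theorem LanfordLebowitzLieb1977_thm3_chain_holds : LanfordLebowitzLieb1977_thm3_chain := by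
  intro P T hT hU hV hB1 hB2 μ hμ
  haveI : IsProbabilityMeasure μ := hμ.1
  have hA : ENNReal.ofReal (Real.sqrt 2) ≠ ∞ := ENNReal.ofReal_ne_top
  exact ae_exists_isSolution_of_measurePreserving (hU.continuous_deriv (by norm_num))
    (hV.continuous_deriv (by norm_num)) (Λ := box) eventually_mem_chainBox
    (T := fun n => severedFlow hB1 (box n))
    (fun n => measurable_severedFlow_uncurry hB1 (box n) hU hV)
    (fun n x => severedFlow_zero hB1 (box n) x)
    (fun n x => isSeveredSolution_severedFlow hB1 (box n) x)
    (fun n t => measurePreserving_severedFlow_of_isChainGibbsMeasure hU hV hB1 (box n) hμ t)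
    (lintegral_momSup_ne_top hT hA fun i =>
      (lintegral_exp_sq_snd hU.continuous hV.continuous hT hB2 hμ i).le)

end OscillatorChain

end Literature.MathematicalPhysics.KineticTheory.HeatConduction

end
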